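import Mathlib
import HarnessLib
import Summits.AtomisticToContinuum.Crystallization.Theorems.FrustratedLawDichotomyTwoShellRigidityLsFitDataFcc01
import Summits.AtomisticToContinuum.Crystallization.Theorems.FrustratedLawDichotomyTwoShellRigidityLsFitDataFcc04
import Summits.AtomisticToContinuum.Crystallization.Theorems.FrustratedLawDichotomyTwoShellRigidityLsFitDataFcc07
import Summits.AtomisticToContinuum.Crystallization.Theorems.FrustratedLawDichotomyTwoShellRigidityLsFitDataFcc10
import Summits.AtomisticToContinuum.Crystallization.Theorems.FrustratedLawDichotomyTwoShellRigidityLsFitDataFcc13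
import Summits.AtomisticToContinuum.Crystallization.Theorems.FrustratedLawDichotomyTwoShellRigidityLsFitDataFcc14

/-!
# Two-shell rigidity, slot 3 · `SphericalLsFit` certificate data (fcc): the full cell list

`fccCellsF` = the 100 decoded cells of the braced ω-sub-leaf B-run of record, concatenated in order from the shard cell lists
(fccCellsF01, fccCellsF04, fccCellsF07, fccCellsF10, fccCellsF13, fccCellsF14); parameters `prmFcc` in `…LsFitPrmFcc`.  decomp-a2c census-1 g22.
-/

namespace Summit.AtomisticToContinuum.Crystallization.Theorems

namespace Rig

/-- The decoded fcc fit cells (all shards, in order). -/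
def fccCellsF : List CellF := fccCellsF01 ++ fccCellsF04 ++ fccCellsF07 ++ fccCellsF10 ++ fccCellsF13 ++ fccCellsF14

end Rig

end Summit.AtomisticToContinuum.Crystallization.Theorems
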